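import Mathlib

/-!
# `OffTetraSectorKernel`, line `odd-hyperbolic-ladder`: boundary trigonometry for the three-triangle relation

Stub `stub_threeTriangles` of the crux `OffTetraSectorKernel` (stmt-KontsevichZagierPeriods-10557), configuration
part. With `S x = √(1 − x²)` (so `x = cos θ`, `S x = sin θ` for `θ = arccos x ∈ [0, π]`) the addition theorem
for the cosine and the sine reads, purely algebraically,
`g b x = b x − S b · S x = cos(θ + B)` and `h b x = b · S x + S b · x = sin(θ + B)` (`b = cos B`).
We prove the identities and inequalities of this boundary trigonometry that drive the rotation move of the
companion file `…StubThreeTrianglesAux`: `g² + h² = 1`, the difference formula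
`(g x − g y)(S x + S y) = (x − y)(h x + h y)` (whence injectivity and monotonicity of `g b` where `h b > 0`),
the positivity `h b x > 0` for `-b < x ≤ 1` (`sin(θ + B) > 0` for `θ + B < π`), and the inverse rotation
`G y = −g b (−y)`, `S (G y) = h b (−y)`, `g b (G y) = y`, `h b (G y) = S y`.

No auxiliary definition is introduced: throughout, `S`, `g`, `h` are function symbols constrained by the
hypotheses `hS : ∀ x, S x = √(1 − x²)`, `hg : ∀ b x, g b x = b x − S b · S x`, `hh : ∀ b x, h b x = b · S x + S b · x`,
which the final theorem instantiates.

References: M. Kontsevich, D. Zagier, *Periods* (2001), §1.1; folklore trigonometry.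
-/

noncomputable section

namespace Summit.KontsevichZagierPeriods.HyperbolicBloch.OffTetraSectorKernel

variable {S : ℝ → ℝ} {g h : ℝ → ℝ → ℝ}

/-! ### Boundary trigonometry in algebraic form -/

/-- `S x ≥ 0`. [folklore] -/
theorem threeTri_S_nonneg (hS : ∀ x, S x = Real.sqrt (1 - x ^ 2)) (x : ℝ) : 0 ≤ S x := by
  rw [hS]
  exact Real.sqrt_nonneg _

/-- `S (−x) = S x`. [folklore] -/
theorem threeTri_S_neg (hS : ∀ x, S x = Real.sqrt (1 - x ^ 2)) (x : ℝ) : S (-x) = S x := by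
  rw [hS, hS, neg_sq]

/-- `(S x)² = 1 − x²` on `[-1, 1]`. [folklore] -/
theorem threeTri_S_sq (hS : ∀ x, S x = Real.sqrt (1 - x ^ 2)) {x : ℝ} (hx : -1 ≤ x) (hx' : x ≤ 1) :
    S x ^ 2 = 1 - x ^ 2 := by
  rw [hS]
  exact Real.sq_sqrt (by nlinarith)

/-- `S x > 0` on `(-1, 1)`. [folklore] -/
theorem threeTri_S_pos (hS : ∀ x, S x = Real.sqrt (1 - x ^ 2)) {x : ℝ} (hx : -1 < x) (hx' : x < 1) :
    0 < S x := by
  rw [hS]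
  exact Real.sqrt_pos.2 (by nlinarith)

/-- `S 1 = 0`. [folklore] -/
theorem threeTri_S_one (hS : ∀ x, S x = Real.sqrt (1 - x ^ 2)) : S 1 = 0 := by
  rw [hS]
  simp

/-- If `S x > 0` then `-1 < x < 1`. [folklore] -/
theorem threeTri_abs_lt_of_S_pos (hS : ∀ x, S x = Real.sqrt (1 - x ^ 2)) {x : ℝ} (h : 0 < S x) :
    -1 < x ∧ x < 1 := by
  rw [hS] at h
  have h1 : 0 < 1 - x ^ 2 := Real.sqrt_pos.1 h
  constructor <;> nlinarith

/-- `S x` is real algebraic for real algebraic `x`. [folklore] -/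
theorem threeTri_isAlgebraic_S (hS : ∀ x, S x = Real.sqrt (1 - x ^ 2)) {x : ℝ} (hx : IsAlgebraic ℚ x) :
    IsAlgebraic ℚ (S x) := by
  rw [hS]
  rcases le_or_gt 0 (1 - x ^ 2) with h | h
  · exact IsAlgebraic.of_pow two_pos (by rw [Real.sq_sqrt h]; exact isAlgebraic_one.sub (hx.pow 2))
  · rw [Real.sqrt_eq_zero'.2 h.le]
    exact isAlgebraic_zero

/-- `g b x` is real algebraic for real algebraic `b, x`. [folklore] -/
theorem threeTri_isAlgebraic_g (hS : ∀ x, S x = Real.sqrt (1 - x ^ 2)) (hg : ∀ b x, g b x = b * x - S b * S x)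
    {b x : ℝ} (hb : IsAlgebraic ℚ b) (hx : IsAlgebraic ℚ x) : IsAlgebraic ℚ (g b x) := by
  rw [hg]
  exact (hb.mul hx).sub ((threeTri_isAlgebraic_S hS hb).mul (threeTri_isAlgebraic_S hS hx))

/-- **Key positivity** (`sin(θ + B) > 0` for `0 ≤ θ < π − B`): for `|b| < 1`, `x ≤ 1` and `-b < x`,
`b · S x + S b · x > 0`. [folklore] -/
theorem threeTri_h_pos (hS : ∀ x, S x = Real.sqrt (1 - x ^ 2)) (hh : ∀ b x, h b x = b * S x + S b * x)
    {b x : ℝ} (hb : -1 < b) (hb' : b < 1) (hx : x ≤ 1) (hbx : -b < x) : 0 < h b x := by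
  rw [hh]
  have hx' : -1 < x := by linarith
  have hsb : 0 < S b := threeTri_S_pos hS hb hb'
  have hs0 : 0 ≤ S x := threeTri_S_nonneg hS x
  have hs2 : S x ^ 2 = 1 - x ^ 2 := threeTri_S_sq hS hx'.le hx
  have hsb2 : S b ^ 2 = 1 - b ^ 2 := threeTri_S_sq hS hb.le hb'.le
  set s := S x with hs_def
  set sb := S b with hsb_def
  rcases lt_or_ge b 0 with hb0 | hb0
  · -- `b < 0 < -b < x`
    have hx0 : 0 < x := by linarith
    have hprod : 0 < (x + b) * (x - b) := mul_pos (by linarith) (by linarith)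
    have h1 : (-b * s) ^ 2 < (sb * x) ^ 2 := by nlinarith
    have h2 : -b * s < sb * x := lt_of_pow_lt_pow_left₀ 2 (by positivity) h1
    linarith
  · rcases lt_or_ge x 0 with hx0 | hx0
    · -- `x < 0 ≤ b`, `-x < b`
      have hprod : 0 < (b + x) * (b - x) := mul_pos (by linarith) (by linarith)
      have h1 : (sb * (-x)) ^ 2 < (b * s) ^ 2 := by nlinarith
      have h2 : sb * (-x) < b * s := lt_of_pow_lt_pow_left₀ 2 (by nlinarith) h1
      linarith
    · -- `0 ≤ x`, `0 ≤ b`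
      rcases eq_or_lt_of_le hx0 with hx0 | hx0
      · have hs1 : s = 1 := by rw [hs_def, ← hx0, hS]; simp
        rw [hs1, ← hx0]
        linarith
      · positivity

/-- Non-strict form of `threeTri_h_pos` (`-b ≤ x`). [folklore] -/
theorem threeTri_h_nonneg (hS : ∀ x, S x = Real.sqrt (1 - x ^ 2)) (hh : ∀ b x, h b x = b * S x + S b * x)
    {b x : ℝ} (hb : -1 < b) (hb' : b < 1) (hx : x ≤ 1) (hbx : -b ≤ x) : 0 ≤ h b x := by
  rcases eq_or_lt_of_le hbx with h | h
  · subst h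
    rw [hh, threeTri_S_neg hS]
    linarith [le_refl (b * S b)]
  · exact (threeTri_h_pos hS hh hb hb' hx h).le

/-- `g² + h² = 1` (`cos² + sin² = 1` for the sum angle). [folklore] -/
theorem threeTri_g_sq_add_h_sq (hS : ∀ x, S x = Real.sqrt (1 - x ^ 2)) (hg : ∀ b x, g b x = b * x - S b * S x)
    (hh : ∀ b x, h b x = b * S x + S b * x) {b x : ℝ} (hb : -1 ≤ b) (hb' : b ≤ 1) (hx : -1 ≤ x) (hx' : x ≤ 1) :
    g b x ^ 2 + h b x ^ 2 = 1 := by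
  have hs := threeTri_S_sq hS hx hx'
  have hsb := threeTri_S_sq hS hb hb'
  rw [hg, hh]
  linear_combination (b ^ 2 + S b ^ 2) * hs + hsb

/-- The difference formula `(g x − g y)(S x + S y) = (x − y)(h x + h y)`. [folklore] -/
theorem threeTri_g_sub_g (hS : ∀ x, S x = Real.sqrt (1 - x ^ 2)) (hg : ∀ b x, g b x = b * x - S b * S x)
    (hh : ∀ b x, h b x = b * S x + S b * x) {b x y : ℝ} (hx : -1 ≤ x) (hx' : x ≤ 1) (hy : -1 ≤ y) (hy' : y ≤ 1) :
    (g b x - g b y) * (S x + S y) = (x - y) * (h b x + h b y) := by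
  have hsx := threeTri_S_sq hS hx hx'
  have hsy := threeTri_S_sq hS hy hy'
  rw [hg, hg, hh, hh]
  linear_combination (-S b) * hsx + S b * hsy

/-- Strict monotonicity of `x ↦ g b x` where `h b ≥ 0`: if `y < x`, `h b x + h b y > 0` and
`S x + S y > 0` then `g b y < g b x`. [folklore] -/
theorem threeTri_g_lt_g (hS : ∀ x, S x = Real.sqrt (1 - x ^ 2)) (hg : ∀ b x, g b x = b * x - S b * S x)
    (hh : ∀ b x, h b x = b * S x + S b * x) {b x y : ℝ} (hx : -1 ≤ x) (hx' : x ≤ 1) (hy : -1 ≤ y) (hy' : y ≤ 1)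
    (hyx : y < x) (hhxy : 0 < h b x + h b y) (hSxy : 0 < S x + S y) : g b y < g b x := by
  have hd := threeTri_g_sub_g hS hg hh (b := b) hx hx' hy hy'
  have hpos : 0 < (g b x - g b y) * (S x + S y) := by
    rw [hd]; exact mul_pos (by linarith) hhxy
  have := pos_of_mul_pos_left hpos hSxy.le
  linarith

/-- Injectivity of `x ↦ g b x` where `h b > 0`. [folklore] -/
theorem threeTri_g_inj (hS : ∀ x, S x = Real.sqrt (1 - x ^ 2)) (hg : ∀ b x, g b x = b * x - S b * S x)
    (hh : ∀ b x, h b x = b * S x + S b * x) {b x y : ℝ} (hx : -1 ≤ x) (hx' : x ≤ 1) (hy : -1 ≤ y) (hy' : y ≤ 1)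
    (hhx : 0 < h b x) (hhy : 0 < h b y) (he : g b x = g b y) : x = y := by
  have hd := threeTri_g_sub_g hS hg hh (b := b) hx hx' hy hy'
  rw [he, sub_self, zero_mul] at hd
  have hne : h b x + h b y ≠ 0 := by linarith
  rcases mul_eq_zero.1 hd.symm with h0 | h0
  · linarith
  · exact absurd h0 hne

/-- `g b 1 = b`. [folklore] -/
theorem threeTri_g_one (hS : ∀ x, S x = Real.sqrt (1 - x ^ 2)) (hg : ∀ b x, g b x = b * x - S b * S x)
    (b : ℝ) : g b 1 = b := by
  rw [hg, threeTri_S_one hS]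
  ring

/-- `h b 1 = S b`. [folklore] -/
theorem threeTri_h_one (hS : ∀ x, S x = Real.sqrt (1 - x ^ 2)) (hh : ∀ b x, h b x = b * S x + S b * x)
    (b : ℝ) : h b 1 = S b := by
  rw [hh, threeTri_S_one hS]
  ring

/-- `g` is symmetric: `g a b = g b a`. [folklore] -/
theorem threeTri_g_comm (hg : ∀ b x, g b x = b * x - S b * S x) (a b : ℝ) : g a b = g b a := by
  rw [hg, hg]
  ring

/-- `cos(A + B) < cos B`: `g b a < b` for `|a|, |b| < 1` with `0 ≤ a + b` (`A + B ≤ π`). [folklore] -/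
theorem threeTri_g_lt_self (hS : ∀ x, S x = Real.sqrt (1 - x ^ 2)) (hg : ∀ b x, g b x = b * x - S b * S x)
    (hh : ∀ b x, h b x = b * S x + S b * x) {a b : ℝ} (ha : -1 < a) (ha' : a < 1) (hb : -1 < b) (hb' : b < 1)
    (hab : 0 ≤ a + b) : g b a < b := by
  have hha : 0 ≤ h b a := threeTri_h_nonneg hS hh hb hb' ha'.le (by linarith)
  have h1 : 0 < h b 1 + h b a := by
    rw [threeTri_h_one hS hh]
    linarith [threeTri_S_pos hS hb hb']
  have h2 : 0 < S 1 + S a := by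
    rw [threeTri_S_one hS]
    linarith [threeTri_S_pos hS ha ha']
  have := threeTri_g_lt_g hS hg hh (b := b) (by norm_num) le_rfl ha.le ha'.le ha' h1 h2
  rwa [threeTri_g_one hS hg] at this

/-- `-1 ≤ cos(A + B)`: `-1 ≤ g b a` for `|a|, |b| ≤ 1`. [folklore] -/
theorem threeTri_neg_one_le_g (hS : ∀ x, S x = Real.sqrt (1 - x ^ 2)) (hg : ∀ b x, g b x = b * x - S b * S x)
    (hh : ∀ b x, h b x = b * S x + S b * x) {a b : ℝ} (ha : -1 ≤ a) (ha' : a ≤ 1) (hb : -1 ≤ b) (hb' : b ≤ 1) :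
    -1 ≤ g b a := by
  nlinarith [threeTri_g_sq_add_h_sq hS hg hh hb hb' ha ha', sq_nonneg (h b a), sq_nonneg (g b a + 1)]

/-! ### The inverse rotation: `G y = −g b (−y) = b y + S b · S y`, `k y = h b (−y) = b · S y − S b · y` -/

/-- `S (−g b (−y)) = h b (−y)` when the latter is non-negative (`sin` of the difference angle). [folklore] -/
theorem threeTri_S_G (hS : ∀ x, S x = Real.sqrt (1 - x ^ 2)) (hg : ∀ b x, g b x = b * x - S b * S x)
    (hh : ∀ b x, h b x = b * S x + S b * x) {b y : ℝ} (hb : -1 ≤ b) (hb' : b ≤ 1) (hy : -1 ≤ y) (hy' : y ≤ 1)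
    (hk : 0 ≤ h b (-y)) : S (-g b (-y)) = h b (-y) := by
  have h1 := threeTri_g_sq_add_h_sq hS hg hh hb hb' (by linarith : -1 ≤ -y) (by linarith)
  rw [hS, neg_sq, show 1 - g b (-y) ^ 2 = h b (-y) ^ 2 by linarith]
  exact Real.sqrt_sq hk

/-- `g b (G y) = y`: the rotation undoes the inverse rotation. [folklore] -/
theorem threeTri_g_G (hS : ∀ x, S x = Real.sqrt (1 - x ^ 2)) (hg : ∀ b x, g b x = b * x - S b * S x)
    (hh : ∀ b x, h b x = b * S x + S b * x) {b y : ℝ} (hb : -1 ≤ b) (hb' : b ≤ 1) (hy : -1 ≤ y) (hy' : y ≤ 1)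
    (hk : 0 ≤ h b (-y)) : g b (-g b (-y)) = y := by
  have hSG := threeTri_S_G hS hg hh hb hb' hy hy' hk
  have hsb := threeTri_S_sq hS hb hb'
  rw [hg, hSG, hg, hh, threeTri_S_neg hS]
  linear_combination y * hsb

/-- `h b (G y) = S y`. [folklore] -/
theorem threeTri_h_G (hS : ∀ x, S x = Real.sqrt (1 - x ^ 2)) (hg : ∀ b x, g b x = b * x - S b * S x)
    (hh : ∀ b x, h b x = b * S x + S b * x) {b y : ℝ} (hb : -1 ≤ b) (hb' : b ≤ 1) (hy : -1 ≤ y) (hy' : y ≤ 1)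
    (hk : 0 ≤ h b (-y)) : h b (-g b (-y)) = S y := by
  have hSG := threeTri_S_G hS hg hh hb hb' hy hy' hk
  have hsb := threeTri_S_sq hS hb hb'
  rw [hh, hSG, hg, hh, threeTri_S_neg hS]
  linear_combination S y * hsb

/-- **Boundary trigonometry of the inverse rotation** (registered helper goal of `stub_threeTriangles`; summary of
this file). For `S x = √(1 − x²)`, `g b x = b x − S b · S x`, `h b x = b · S x + S b · x` and `|b|, |y| ≤ 1` with
`h b (−y) ≥ 0` (the difference angle `θ' − B` lies in `[0, π]`), the point `G y = −g b (−y) = cos(θ' − B)` satisfies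
`S (G y) = h b (−y)`, `g b (G y) = y`, `h b (G y) = S y`: rotating back by `B` and then forth by `B` is the identity
on the boundary circle. [folklore] -/
theorem threeTri_boundaryTrig :
    ∀ (S : ℝ → ℝ) (g h : ℝ → ℝ → ℝ), (∀ x, S x = Real.sqrt (1 - x ^ 2)) →
      (∀ b x, g b x = b * x - S b * S x) → (∀ b x, h b x = b * S x + S b * x) →
    ∀ (b y : ℝ), -1 ≤ b → b ≤ 1 → -1 ≤ y → y ≤ 1 → 0 ≤ h b (-y) →
      S (-g b (-y)) = h b (-y) ∧ g b (-g b (-y)) = y ∧ h b (-g b (-y)) = S y := by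
  intro S g h hS hg hh b y hb hb' hy hy' hk
  exact ⟨threeTri_S_G hS hg hh hb hb' hy hy' hk, threeTri_g_G hS hg hh hb hb' hy hy' hk,
    threeTri_h_G hS hg hh hb hb' hy hy' hk⟩

end Summit.KontsevichZagierPeriods.HyperbolicBloch.OffTetraSectorKernel

end
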